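import Mathlib.LinearAlgebra.Matrix.SpecialLinearGroup
import Mathlib.LinearAlgebra.Matrix.GeneralLinearGroup.Defs
import Mathlib.Data.ZMod.Basic
import Mathlib.Algebra.Field.ZMod
import Mathlib.Tactic.LinearCombination
import Literature.IUT.HodgeTheaters.BorelLabels
import Literature.AnabelianGeometry.AbsoluteAnabelian.ProfiniteTerminology
import HarnessLib

/-!
# [IUTchI] §6, Remark 6.12.6 (iv): the Borel subgroup of `SL₂(𝔽_l)` is normally terminal, the
# semi-unipotent subgroup `{(±1 *; 0 ±1)}` is not (abc-iut cell, layer L5, wave-2 row W2-L5-03b)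

Mochizuki, *Inter-universal Teichmüller theory I: construction of Hodge theaters*, §6, kurims FINAL
MANUSCRIPT (May 2020; lit key `paper:url-690e7b3c6199`, PDF page = printed page), Remark 6.12.6 (iv),
p. 181: "One way to understand the difference discussed in (iii) between the global portions [i.e.,
the portions involving copies of `𝒟^⊚`, `𝒟^{⊚±}`] of a [`𝒟`-]`ΘNF`-Hodge theater and a
[`𝒟`-]`Θ^{±ell}`-Hodge theater is as a reflection of the fact that whereas the Borel subgroup
`{(* *; 0 *)} ⊆ SL₂(𝔽_l)` is normally terminal in `SL₂(𝔽_l)` [cf. the discussion of Example 4.3],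
the "semi-unipotent" subgroup `{(±1 *; 0 ±1)} ⊆ SL₂(𝔽_l)` [which corresponds to the subgroup
`Aut_±(𝒟^{⊚±}) ⊆ Aut(𝒟^{⊚±})` — cf. the discussion of Definition 6.1, (v)] fails to be normally
terminal in `SL₂(𝔽_l)`."

This file PROVES the group theory of that sentence over Mathlib's `SL(2, ZMod l)` and the tree's
`IsNormallyTerminal` ("equal to its own normaliser", [AbsAnab] Def 0.1 (iii),
`Literature.AnabelianGeometry.AbsoluteAnabelian.ProfiniteTerminology`):
* `SL2.borelSL`, `SL2.semiUnipSL` — the two subgroups (inside `SL₂` a semi-unipotent element has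
  diagonal `(ε, ε)`, `ε = ±1`, the determinant being `1`); `SL2.toGL_mem_borel_iff` /
  `SL2.toGL_mem_semiUnipPM_iff` identify them with the pull-backs of the GL₂-forms of [IUTchI] Ex 4.3
  (i) in `BorelLabels.lean` (abc-iut-L5-t3) — no second notion is introduced;
* `SL2.borelSL_isNormallyTerminal` (`l` prime): `N(B) = B`, because an element normalising `B`
  conjugates the unipotent `u = (1 1; 0 1)` into `B`, and `(g u g⁻¹)₁₀ = −c²`;
* `SL2.normalizer_semiUnipSL` (`l` prime): the normaliser of the semi-unipotent subgroup IS the Borel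
  subgroup (the whole Borel normalises it over any modulus, `SL2.borelSL_le_normalizer_semiUnipSL`);
* `SL2.not_isNormallyTerminal_semiUnipSL`, `SL2.rmk6126_iv` (prime `l ≥ 5`): the failure, witnessed
  by `diag(2⁻¹, 2)`. For `l ∈ {2, 3}` one has `𝔽_lˣ = {±1}`, the two subgroups coincide and the
  semi-unipotent subgroup IS normally terminal — so the printed "fails" genuinely uses `l ≥ 5`, the
  standing hypothesis of [IUTchI] Def 3.1 (c); the hypothesis is carried explicitly, not hidden.
The surrounding prose of Remark 6.12.6 (i)–(iii), (v) and Remark 6.12.5 is indexed in the sibling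
file `PMTheatersRemarksB.lean`. Record-only: [claim: Mochizuki2012, status: disputed] on every
declaration; the mathematics proved here is classical finite group theory, independent of the
dispute, and nothing takes a side on [IUTchIII] Cor. 3.12.
-/

namespace Literature.IUT.HodgeTheaters

open Matrix
open scoped MatrixGroups
open Literature.AnabelianGeometry.AbsoluteAnabelian (IsNormallyTerminal)

namespace SL2

variable (l : ℕ)

/-- The Borel subgroup `{(* *; 0 *)} ⊆ SL₂(𝔽_l)` of upper-triangular elements.
([IUTchI] Rmk 6.12.6 (iv), p. 181; cf. Ex 4.3 (i) p. 98) [claim: Mochizuki2012, status: disputed] -/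
def borelSL : Subgroup SL(2, ZMod l) where
  carrier := {g | g 1 0 = 0}
  one_mem' := by simp
  mul_mem' {g h} hg hh := by
    simp only [Set.mem_setOf_eq] at hg hh ⊢
    simp [Matrix.mul_apply, Fin.sum_univ_two, hg, hh]
  inv_mem' {g} hg := by
    simp only [Set.mem_setOf_eq] at hg ⊢
    rw [Matrix.SpecialLinearGroup.SL2_inv_expl]
    simp [hg]

variable {l} in
/-- Membership in the Borel subgroup of `SL₂(𝔽_l)`: lower-left entry `0`.
([IUTchI] Rmk 6.12.6 (iv), p. 181) [claim: Mochizuki2012, status: disputed] -/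
theorem mem_borelSL_iff (g : SL(2, ZMod l)) : g ∈ borelSL l ↔ g 1 0 = 0 := Iff.rfl

variable {l} in
/-- For an upper-triangular element of `SL₂` the diagonal entries are mutually inverse:
`g₀₀ g₁₁ = 1`. [claim: Mochizuki2012, status: disputed] -/
theorem diag_mul_eq_one {g : SL(2, ZMod l)} (hg : g 1 0 = 0) : g 0 0 * g 1 1 = 1 := by
  have h := g.2
  rw [Matrix.det_fin_two] at h
  simpa [hg] using h

/-- The "semi-unipotent" subgroup `{(±1 *; 0 ±1)} ⊆ SL₂(𝔽_l)`: upper-triangular with lower-right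
(hence, the determinant being `1`, both diagonal) entries `±1`. ([IUTchI] Rmk 6.12.6 (iv), p. 181;
cf. Ex 4.3 (i) p. 98 "semi-unipotent, up to `±1`") [claim: Mochizuki2012, status: disputed] -/
def semiUnipSL : Subgroup SL(2, ZMod l) where
  carrier := {g | g 1 0 = 0 ∧ (g 1 1 = 1 ∨ g 1 1 = -1)}
  one_mem' := by simp
  mul_mem' {g h} hg hh := by
    obtain ⟨hg0, hg1⟩ := hg
    obtain ⟨hh0, hh1⟩ := hh
    refine ⟨by simp [Matrix.mul_apply, Fin.sum_univ_two, hg0, hh0], ?_⟩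
    have e : (g * h) 1 1 = g 1 1 * h 1 1 := by simp [Matrix.mul_apply, Fin.sum_univ_two, hg0]
    rw [e]
    rcases hg1 with h1 | h1 <;> rcases hh1 with h2 | h2 <;> simp [h1, h2]
  inv_mem' {g} hg := by
    obtain ⟨hg0, hg1⟩ := hg
    have had : g 0 0 * g 1 1 = 1 := diag_mul_eq_one hg0
    have h00 : g 0 0 = 1 ∨ g 0 0 = -1 := by
      rcases hg1 with h1 | h1
      · left; rwa [h1, mul_one] at had
      · right; rw [h1, mul_neg_one, neg_eq_iff_eq_neg] at had; exact had
    rw [Matrix.SpecialLinearGroup.SL2_inv_expl]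
    refine ⟨by simp [hg0], ?_⟩
    simpa using h00

variable {l} in
/-- Membership in the semi-unipotent subgroup of `SL₂(𝔽_l)`.
([IUTchI] Rmk 6.12.6 (iv), p. 181) [claim: Mochizuki2012, status: disputed] -/
theorem mem_semiUnipSL_iff (g : SL(2, ZMod l)) :
    g ∈ semiUnipSL l ↔ g 1 0 = 0 ∧ (g 1 1 = 1 ∨ g 1 1 = -1) := Iff.rfl

/-- `{(±1 *; 0 ±1)} ⊆ {(* *; 0 *)}`. ([IUTchI] Rmk 6.12.6 (iv), p. 181)
[claim: Mochizuki2012, status: disputed] -/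
theorem semiUnipSL_le_borelSL : semiUnipSL l ≤ borelSL l := fun _ hg => hg.1

/-- Bridge to the GL₂-form of [IUTchI] Ex 4.3 (i) (`BorelLabels.lean`, abc-iut-L5-t3): an element
of `SL₂(𝔽_l)` lies in `borelSL` iff its image in `GL₂(𝔽_l)` lies in `BorelLabels.borel` — the SL₂
Borel is the pull-back of the GL₂ one, not a second notion. [claim: Mochizuki2012, status: disputed] -/
theorem toGL_mem_borel_iff [Fact l.Prime] (g : SL(2, ZMod l)) :
    Matrix.SpecialLinearGroup.toGL g ∈ BorelLabels.borel l ↔ g ∈ borelSL l := Iff.rfl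

/-- Bridge, continued: for `g` in the SL₂ Borel, its image in the GL₂ Borel lies in the kernel
`BorelLabels.semiUnipPM` ("lower-right entry `±1`") iff `g ∈ semiUnipSL`.
[claim: Mochizuki2012, status: disputed] -/
theorem toGL_mem_semiUnipPM_iff [Fact l.Prime] (g : SL(2, ZMod l)) (hg : g ∈ borelSL l) :
    (⟨Matrix.SpecialLinearGroup.toGL g, (toGL_mem_borel_iff l g).2 hg⟩ : BorelLabels.borel l) ∈
        BorelLabels.semiUnipPM l ↔ g ∈ semiUnipSL l := by
  rw [BorelLabels.mem_semiUnipPM_iff, mem_semiUnipSL_iff]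
  exact ⟨fun h => ⟨hg, h⟩, fun h => h.2⟩

/-- The unipotent element `u = (1 1; 0 1) ∈ SL₂(𝔽_l)`. [claim: Mochizuki2012, status: disputed] -/
def unip : SL(2, ZMod l) := ⟨!![1, 1; 0, 1], by simp [Matrix.det_fin_two_of]⟩

/-- `u` is semi-unipotent (indeed unipotent). [claim: Mochizuki2012, status: disputed] -/
theorem unip_mem_semiUnipSL : unip l ∈ semiUnipSL l :=
  ⟨by simp [unip], Or.inl (by simp [unip])⟩

variable {l} in
/-- The key computation: for `g = (a b; c d) ∈ SL₂`, the lower-left entry of `g u g⁻¹` is `−c²`.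
[claim: Mochizuki2012, status: disputed] -/
theorem conj_unip_apply_one_zero (g : SL(2, ZMod l)) : (g * unip l * g⁻¹) 1 0 = -(g 1 0) ^ 2 := by
  rw [Matrix.SpecialLinearGroup.SL2_inv_expl]
  simp [unip, Matrix.mul_apply, Fin.sum_univ_two]
  ring

variable {l} in
/-- Over the FIELD `𝔽_l` (`l` prime): if `g u g⁻¹` is upper-triangular then so is `g`.
[claim: Mochizuki2012, status: disputed] -/
theorem apply_one_zero_eq_zero_of_conj_unip_mem [Fact l.Prime] {g : SL(2, ZMod l)}
    (h : g * unip l * g⁻¹ ∈ borelSL l) : g 1 0 = 0 := by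
  have h' : -(g 1 0) ^ 2 = 0 := by rw [← conj_unip_apply_one_zero]; exact h
  exact (pow_eq_zero_iff two_ne_zero).mp (neg_eq_zero.mp h')

/-- **Rmk 6.12.6 (iv), first half**: "the Borel subgroup `{(* *; 0 *)} ⊆ SL₂(𝔽_l)` is normally
terminal in `SL₂(𝔽_l)`" — `N_{SL₂(𝔽_l)}(B) = B` for `l` prime (an element normalising `B` conjugates
the unipotent `u ∈ B` into `B`, forcing its lower-left entry `c` to satisfy `c² = 0`).
([IUTchI] Rmk 6.12.6 (iv), p. 181) [claim: Mochizuki2012, status: disputed] -/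
theorem borelSL_isNormallyTerminal [Fact l.Prime] : IsNormallyTerminal (borelSL l) := by
  refine ⟨le_antisymm (fun g hg => ?_) Subgroup.le_normalizer⟩
  have h := (Subgroup.mem_normalizer_iff.mp hg (unip l)).mp
    (semiUnipSL_le_borelSL l (unip_mem_semiUnipSL l))
  exact apply_one_zero_eq_zero_of_conj_unip_mem h

/-- The whole Borel subgroup normalises the semi-unipotent subgroup (any modulus `l`): conjugating
`(p q; r s)` by `(a b; 0 d)` with `ad = 1` gives lower row `(d² r, s − b d r)`.
([IUTchI] Rmk 6.12.6 (iv), p. 181) [claim: Mochizuki2012, status: disputed] -/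
theorem borelSL_le_normalizer_semiUnipSL :
    borelSL l ≤ Subgroup.normalizer (semiUnipSL l : Set SL(2, ZMod l)) := by
  intro g hg
  have hg0 : g 1 0 = 0 := hg
  have had : g 0 0 * g 1 1 = 1 := diag_mul_eq_one hg0
  have hu : IsUnit (g 1 1) := IsUnit.of_mul_eq_one_right (g 0 0) had
  rw [Subgroup.mem_normalizer_iff]
  intro h
  have e10 : (g * h * g⁻¹) 1 0 = g 1 1 ^ 2 * h 1 0 := by
    rw [Matrix.SpecialLinearGroup.SL2_inv_expl]
    simp [Matrix.mul_apply, Fin.sum_univ_two, hg0]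
    ring
  have e11 : (g * h * g⁻¹) 1 1 = g 0 0 * g 1 1 * h 1 1 - g 0 1 * g 1 1 * h 1 0 := by
    rw [Matrix.SpecialLinearGroup.SL2_inv_expl]
    simp [Matrix.mul_apply, Fin.sum_univ_two, hg0]
    ring
  rw [had, one_mul] at e11
  rw [mem_semiUnipSL_iff, mem_semiUnipSL_iff, e10, e11]
  constructor
  · rintro ⟨hr, hs⟩
    refine ⟨by rw [hr, mul_zero], ?_⟩
    rw [hr, mul_zero, sub_zero]
    exact hs
  · rintro ⟨hr', hs'⟩
    have hr : h 1 0 = 0 := (hu.pow 2).mul_right_eq_zero.mp hr'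
    refine ⟨hr, ?_⟩
    rw [hr, mul_zero, sub_zero] at hs'
    exact hs'

/-- For `l` prime the normaliser of the semi-unipotent subgroup of `SL₂(𝔽_l)` IS the Borel subgroup.
([IUTchI] Rmk 6.12.6 (iv), p. 181) [claim: Mochizuki2012, status: disputed] -/
theorem normalizer_semiUnipSL [Fact l.Prime] :
    Subgroup.normalizer (semiUnipSL l : Set SL(2, ZMod l)) = borelSL l := by
  refine le_antisymm (fun g hg => ?_) (borelSL_le_normalizer_semiUnipSL l)
  have h := (Subgroup.mem_normalizer_iff.mp hg (unip l)).mp (unip_mem_semiUnipSL l)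
  exact apply_one_zero_eq_zero_of_conj_unip_mem (semiUnipSL_le_borelSL l h)

/-- The diagonal element `diag(a⁻¹, a) ∈ SL₂(𝔽_l)` attached to a unit `a ∈ 𝔽_lˣ`.
[claim: Mochizuki2012, status: disputed] -/
def diagSL (a : (ZMod l)ˣ) : SL(2, ZMod l) :=
  ⟨!![((a⁻¹ : (ZMod l)ˣ) : ZMod l), 0; 0, (a : ZMod l)], by
    rw [Matrix.det_fin_two_of]; simp⟩

/-- `diag(a⁻¹, a)` is upper-triangular. [claim: Mochizuki2012, status: disputed] -/
theorem diagSL_mem_borelSL (a : (ZMod l)ˣ) : diagSL l a ∈ borelSL l := by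
  simp [mem_borelSL_iff, diagSL]

/-- `diag(a⁻¹, a)` is semi-unipotent iff `a = ±1`. [claim: Mochizuki2012, status: disputed] -/
theorem diagSL_mem_semiUnipSL_iff (a : (ZMod l)ˣ) :
    diagSL l a ∈ semiUnipSL l ↔ (a : ZMod l) = 1 ∨ (a : ZMod l) = -1 := by
  simp [mem_semiUnipSL_iff, diagSL]

/-- The lower-right entry of an upper-triangular element of `SL₂(𝔽_l)`, as a unit (its inverse is
the upper-left entry). [claim: Mochizuki2012, status: disputed] -/
def lowerRightUnit (g : borelSL l) : (ZMod l)ˣ :=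
  ⟨(g : SL(2, ZMod l)) 1 1, (g : SL(2, ZMod l)) 0 0,
    by rw [mul_comm]; exact diag_mul_eq_one g.2, diag_mul_eq_one g.2⟩

/-- The value of `lowerRightUnit` is the `(1,1)` entry. [claim: Mochizuki2012, status: disputed] -/
@[simp] theorem val_lowerRightUnit (g : borelSL l) :
    (lowerRightUnit l g : ZMod l) = (g : SL(2, ZMod l)) 1 1 := rfl

/-- The bracket of Rmk 6.12.6 (iv) "[which corresponds to the subgroup `Aut_±(𝒟^{⊚±}) ⊆ Aut(𝒟^{⊚±})`
— cf. Definition 6.1, (v)]" in matrix form: Def 6.1 (v) (p. 158) obtains `Aut_±(𝒟^{⊚±})` as the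
KERNEL of "a natural surjective homomorphism `Aut(𝒟^{⊚±}) ↠ 𝔽_l^⋇`" determined by a rank-one
quotient, the image of `Aut(𝒟^{⊚±})` containing "a Borel subgroup of `SL₂(𝔽_l)/{±1}`". On the Borel
subgroup of `SL₂(𝔽_l)` that homomorphism is "lower-right entry modulo `±1`", `B ↠ 𝔽_l^⋇ = 𝔽_lˣ/{±1}`
(the GL₂-form is `BorelLabels.borelLabel`; the abstract Def 6.1 (v) datum is abc-iut-L5-t4's
`PMBaseKit.toFlStar` with kernel `PMBaseKit.autPMg`). ([IUTchI] Def 6.1 (v) p. 158; Rmk 6.12.6 (iv)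
p. 181)
[claim: Mochizuki2012, status: disputed] -/
def borelSLLabel : borelSL l →* FlStar l where
  toFun g := FlStar.mk l (lowerRightUnit l g)
  map_one' := by
    have h : lowerRightUnit l 1 = 1 := Units.ext (by simp)
    rw [h]; rfl
  map_mul' g h := by
    have hmul : lowerRightUnit l (g * h) = lowerRightUnit l g * lowerRightUnit l h := Units.ext (by
      have hg0 : (g : SL(2, ZMod l)) 1 0 = 0 := g.2
      simp [Matrix.mul_apply, Fin.sum_univ_two, hg0])
    rw [hmul]; rfl

/-- The label homomorphism kills exactly the semi-unipotent elements: `B ↠ 𝔽_l^⋇` has kernel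
`{(±1 *; 0 ±1)}` — the matrix form of "`Aut_±(𝒟^{⊚±})` = kernel of `Aut(𝒟^{⊚±}) ↠ 𝔽_l^⋇`".
([IUTchI] Def 6.1 (v) p. 158; Rmk 6.12.6 (iv) p. 181) [claim: Mochizuki2012, status: disputed] -/
theorem borelSLLabel_eq_one_iff (g : borelSL l) :
    borelSLLabel l g = 1 ↔ (g : SL(2, ZMod l)) ∈ semiUnipSL l := by
  change FlStar.mk l (lowerRightUnit l g) = ((1 : (ZMod l)ˣ) : FlStar l) ↔ _
  rw [FlStar.mk, QuotientGroup.eq, mem_unitsPlusMinus_iff, mem_semiUnipSL_iff]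
  simp only [mul_one, inv_eq_iff_eq_inv, inv_one, Units.ext_iff, val_lowerRightUnit, Units.val_one]
  rw [show ((-1 : (ZMod l)ˣ)⁻¹ : (ZMod l)ˣ) = -1 from by simp, Units.val_neg, Units.val_one]
  exact ⟨fun h => ⟨g.2, h⟩, fun h => h.2⟩

/-- The kernel of `B ↠ 𝔽_l^⋇` is the semi-unipotent subgroup (viewed inside `B`).
[claim: Mochizuki2012, status: disputed] -/
theorem ker_borelSLLabel : (borelSLLabel l).ker = (semiUnipSL l).subgroupOf (borelSL l) := by
  ext g
  rw [MonoidHom.mem_ker, Subgroup.mem_subgroupOf, borelSLLabel_eq_one_iff]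

/-- `B ↠ 𝔽_l^⋇` is surjective (`diag(u⁻¹, u) ↦ [u]`). [claim: Mochizuki2012, status: disputed] -/
theorem borelSLLabel_surjective : Function.Surjective (borelSLLabel l) := by
  intro j
  induction j using QuotientGroup.induction_on with
  | H u =>
    refine ⟨⟨diagSL l u, diagSL_mem_borelSL l u⟩, ?_⟩
    have h : lowerRightUnit l ⟨diagSL l u, diagSL_mem_borelSL l u⟩ = u :=
      Units.ext (by simp [diagSL])
    change FlStar.mk l _ = _
    rw [h]

/-- The semi-unipotent subgroup is normal in the Borel subgroup (it is a kernel).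
[claim: Mochizuki2012, status: disputed] -/
instance semiUnipSL_subgroupOf_normal : ((semiUnipSL l).subgroupOf (borelSL l)).Normal := by
  rw [← ker_borelSLLabel]; infer_instance

/-- "`Aut(𝒟^{⊚±})/Aut_±(𝒟^{⊚±}) ⥲ 𝔽_l^⋇`" (the rigidity of Rmk 6.12.6 (iii); Def 6.1 (v)) in
SL₂-matrix form: Borel modulo semi-unipotent is `𝔽_l^⋇`. ([IUTchI] Def 6.1 (v) p. 158; Rmk 6.12.6
(iii)(iv) p. 181) [claim: Mochizuki2012, status: disputed] -/
noncomputable def borelSLQuotientEquiv :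
    borelSL l ⧸ (semiUnipSL l).subgroupOf (borelSL l) ≃* FlStar l :=
  (QuotientGroup.quotientMulEquivOfEq (ker_borelSLLabel l)).symm.trans
    (QuotientGroup.quotientKerEquivOfSurjective _ (borelSLLabel_surjective l))

variable {l} in
/-- For `l ≥ 5` the element `2 ∈ 𝔽_l` is a unit different from `±1` (`l ∤ 2`, `l ∤ 1`, `l ∤ 3`) —
this is exactly where `l ≥ 5` enters: for `l ∈ {2, 3}` one has `𝔽_lˣ = {±1}` and the semi-unipotent
subgroup equals the Borel. [claim: Mochizuki2012, status: disputed] -/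
theorem two_ne_zero_one_neg_one (hl : 5 ≤ l) :
    (2 : ZMod l) ≠ 0 ∧ (2 : ZMod l) ≠ 1 ∧ (2 : ZMod l) ≠ -1 := by
  have hdvd : ∀ n : ℕ, ((n : ℕ) : ZMod l) = 0 → l ∣ n := fun n hn =>
    (ZMod.natCast_eq_zero_iff n l).mp hn
  refine ⟨fun h => ?_, fun h => ?_, fun h => ?_⟩
  · have h2 : ((2 : ℕ) : ZMod l) = 0 := by push_cast; exact h
    have := Nat.le_of_dvd (by norm_num) (hdvd 2 h2)
    omega
  · have h1 : ((1 : ℕ) : ZMod l) = 0 := by push_cast; linear_combination h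
    have := Nat.le_of_dvd (by norm_num) (hdvd 1 h1)
    omega
  · have h3 : ((3 : ℕ) : ZMod l) = 0 := by push_cast; linear_combination h
    have := Nat.le_of_dvd (by norm_num) (hdvd 3 h3)
    omega

/-- For prime `l ≥ 5` the semi-unipotent subgroup is STRICTLY smaller than the Borel subgroup:
`diag(2⁻¹, 2)` is upper-triangular but not semi-unipotent. ([IUTchI] Rmk 6.12.6 (iv), p. 181;
`l ≥ 5` is [IUTchI] Def 3.1 (c)) [claim: Mochizuki2012, status: disputed] -/
theorem semiUnipSL_ne_borelSL [Fact l.Prime] (hl : 5 ≤ l) : semiUnipSL l ≠ borelSL l := by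
  obtain ⟨h0, h1, hm1⟩ := two_ne_zero_one_neg_one hl
  intro heq
  have hmem : diagSL l (Units.mk0 (2 : ZMod l) h0) ∈ semiUnipSL l := by
    rw [heq]; exact diagSL_mem_borelSL l _
  rw [diagSL_mem_semiUnipSL_iff] at hmem
  rcases hmem with h | h
  · exact h1 (by simpa using h)
  · exact hm1 (by simpa using h)

/-- **Rmk 6.12.6 (iv), second half**: "the "semi-unipotent" subgroup `{(±1 *; 0 ±1)} ⊆ SL₂(𝔽_l)`
fails to be normally terminal in `SL₂(𝔽_l)`" — for prime `l ≥ 5` its normaliser is the Borel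
subgroup, which is strictly larger. ([IUTchI] Rmk 6.12.6 (iv), p. 181)
[claim: Mochizuki2012, status: disputed] -/
theorem not_isNormallyTerminal_semiUnipSL [Fact l.Prime] (hl : 5 ≤ l) :
    ¬ IsNormallyTerminal (semiUnipSL l) := by
  intro h
  have := h.normalizer_eq
  rw [normalizer_semiUnipSL] at this
  exact semiUnipSL_ne_borelSL l hl this.symm

/-- **Rmk 6.12.6 (iv)** as printed, both halves in one statement (prime `l ≥ 5`): the Borel subgroup
of `SL₂(𝔽_l)` is normally terminal and the semi-unipotent subgroup is not.
([IUTchI] Rmk 6.12.6 (iv), p. 181) [claim: Mochizuki2012, status: disputed] -/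
theorem rmk6126_iv [Fact l.Prime] (hl : 5 ≤ l) :
    IsNormallyTerminal (borelSL l) ∧ ¬ IsNormallyTerminal (semiUnipSL l) :=
  ⟨borelSL_isNormallyTerminal l, not_isNormallyTerminal_semiUnipSL l hl⟩

/-- Sharpness of the hypothesis `l ≥ 5`: if every unit of `ZMod l` is `±1` then the semi-unipotent
subgroup IS the Borel subgroup (the lower-right entry of an upper-triangular element of `SL₂` is a
unit). [claim: Mochizuki2012, status: disputed] -/
theorem semiUnipSL_eq_borelSL_of_units (h : ∀ u : (ZMod l)ˣ, (u : ZMod l) = 1 ∨ (u : ZMod l) = -1) :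
    semiUnipSL l = borelSL l := by
  refine le_antisymm (semiUnipSL_le_borelSL l) fun g hg => ?_
  obtain ⟨u, hu⟩ := IsUnit.of_mul_eq_one_right (g 0 0) (diag_mul_eq_one hg)
  exact ⟨hg, by rw [← hu]; exact h u⟩

/-- Sharpness, concretely: for `l = 3` (where `𝔽_3ˣ = {±1}`) the semi-unipotent subgroup of `SL₂(𝔽_3)`
equals the Borel subgroup and hence IS normally terminal — the printed "fails to be normally terminal"
uses `l ≥ 5` ([IUTchI] Def 3.1 (c)). [claim: Mochizuki2012, status: disputed] -/
theorem semiUnipSL_three_isNormallyTerminal : IsNormallyTerminal (semiUnipSL 3) := by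
  have key : ∀ x : ZMod 3, x ≠ 0 → x = 1 ∨ x = -1 := by decide
  rw [semiUnipSL_eq_borelSL_of_units 3 fun u => key _ u.ne_zero]
  exact borelSL_isNormallyTerminal 3

end SL2

end Literature.IUT.HodgeTheaters
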